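import Mathlib
import Literature.Probability.RandomMatrix.LovasAndaiLemma6Norm

/-!
# Lovas–Andai Lemma 6: `χ̃₁(ε) = (4/π²)∫₀^ε (s + 1/s − ½(s − 1/s)² log((1+s)/(1−s))) ds/s`

Proof of the named fact `LovasAndai2017_lemma6` (A. Lovas, A. Andai, *Invariance of separability
probability over reduced states in 4 × 4 bipartite systems*, J. Phys. A 50 (2017) 295303, Lemma 6,
proof in Appendix A; arXiv:1610.01410 [LovasAndai2017]): `LovasAndai2017_lemma6_holds` at the end
of this file. Theorem-only; all definitions (`twiceOpNorm`, `normSet`, `regroup₂`, `hypChart`,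
`hypNorm`, `mStar`, `defectDensity`) and the value `χ₁(1) = 2π²/3` are in
`LovasAndaiLemma6Norm.lean`.

## Part A — reduction of `χ₁(e^{-δ})` to a one-dimensional integral

Following the architecture of [LovasAndai2017, App. A] — choose coordinates in which the similarity
`X ↦ V_ε⁻¹ X V_ε` (`ε = e^{-δ}`) is a translation by `δ` of one coordinate, observe that the unit-ball
condition along that coordinate line is a symmetric interval, so that the intersection of the ball
with its translate is governed by "the half-length exceeds `δ/2`" (the split at `t = δ/2` in App. A),
and integrate out everything else — we prove (`volume_normSet_exp_neg`)

`vol(normSet (e^{-δ})) = 4 ∫⁻_{t > δ} ∫⁻_{(a,d) ∈ ℝ²} vol{m > 0 : hypNorm a d m (t/2) < 2} dt`  (`δ ≥ 0`).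

Concretely: Fubini over the diagonal entries `(a, d)`; the reflections `(b,c) ↦ (−b,−c)` and
`(b,d) ↦ (−b,−d)` reduce the off-diagonal plane to the open quadrant `{b, c > 0}` (factor `4`); the
hyperbolic chart `(b, c) = (√m e^τ, √m e^{-τ})` has Jacobian `1` and turns the similarity into
`τ ↦ τ − δ`; the norm `hypNorm a d m τ` is even and monotone in `|τ|`, whence
`vol{τ : G(τ) < 2 ∧ G(τ − δ) < 2} = vol{t > δ : G(t/2) < 2}` (`volume_overlap_shift`: split at
`τ = δ/2`, reflect, rescale); finally Tonelli moves `t` outside.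

## Part B — the closed form (all for `t > 0`, `C = cosh t`, `S = sinh t`)

* `mSection_eq_Ioo` / `mSection_eq_empty` — the `m`-section `{m > 0 : hypNorm a d m (t/2) < 2}` is
  the interval `(0, m*)`, `m* = C + ad − √(S² + a² + d² + 2adC)`, when `|a|, |d| < 1`, and empty
  otherwise (strict monotonicity in `m`, and the explicit root: `hypNorm a d m* (t/2) = 2` because
  `√((a+d)² + 2m*(C−1)) = 1 + ad − m*`, `√((a−d)² + 2m*(C+1)) = 1 − ad + m*`);
* `integral_sqrt_inner` — `∫_{-1}^{1} √(S² + a² + d² + 2adC) dd = C(1+a²) + (S²(1−a²)/2) log((C+1)/(C−1))`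
  by the primitive `(u√(u²+k²) + k² log(u + √(u²+k²)))/2`, `u = d + aC`, `k² = S²(1−a²)`, whose
  endpoint values are `√((aC ± 1)² + k²) = C ± a`;
* hence `∫∫_{(-1,1)²} m* = (4/3)(C − (S²/2) log((C+1)/(C−1))) = defectDensity t` and
  `vol(normSet (e^{-δ})) = 4 ∫_{δ}^{∞} defectDensity` — this is [LovasAndai2017, App. A, last
  display] `Δ(δ) = (16/3)∫₀^δ (cosh t − sinh² t·log((e^t+1)/(e^t−1))) dt` in the form
  `χ₁(e^{-δ}) = (16/3)∫_δ^∞ (…) dt` (note `log((e^t+1)/(e^t−1)) = ½ log((C+1)/(C−1))`);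
* the substitution `s = e^{-t}` turns `4·defectDensity(−log s)/s` into `(8/3)` times the printed
  integrand `(s + 1/s − ½(s − 1/s)² log((1+s)/(1−s)))/s`, and dividing by `χ₁(1) = 2π²/3`
  (`LovasAndaiLemma6Norm.lean`) gives Lemma 6.

## References

* [LovasAndai2017] Lovas–Andai 2017, Definition 1, Lemma 6, §5, Appendix A. arXiv:1610.01410.
-/

noncomputable section

open MeasureTheory Set Real
open scoped ENNReal

namespace Literature.Probability.RandomMatrix.LovasAndaiLemma6

/-! ## Part A: reduction to one dimension -/

/-! ### Two generic measure-theoretic lemmas -/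

/-- If `σ` preserves `μ` and `A`, reverses the sign of a coordinate `ℓ`, and `{ℓ = 0}` is `μ`-null,
then `μ A = 2 μ (A ∩ {ℓ > 0})`. [folklore] -/
theorem measure_eq_two_mul_of_symm {α : Type*} [MeasurableSpace α] (μ : Measure α) {A : Set α}
    (hA : MeasurableSet A) {ℓ : α → ℝ} (hℓ : Measurable ℓ) (hnull : μ {x | ℓ x = 0} = 0)
    {σ : α → α} (hσ : MeasurePreserving σ μ μ) (hσA : ∀ x, σ x ∈ A ↔ x ∈ A)
    (hσℓ : ∀ x, ℓ (σ x) = -ℓ x) :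
    μ A = 2 * μ (A ∩ {x | 0 < ℓ x}) := by
  have hP : MeasurableSet {x | 0 < ℓ x} := measurableSet_lt measurable_const hℓ
  have hAP : MeasurableSet (A ∩ {x | 0 < ℓ x}) := hA.inter hP
  rw [← measure_inter_add_sdiff A hP, two_mul]
  congr 1
  have h1 : A \ {x | 0 < ℓ x} = A ∩ {x | ℓ x ≤ 0} := by
    ext x; simp [not_lt]
  have h2 : A ∩ {x | ℓ x < 0} = σ ⁻¹' (A ∩ {x | 0 < ℓ x}) := by
    ext x
    simp only [mem_inter_iff, mem_setOf_eq, mem_preimage, hσA, hσℓ, neg_pos]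
  rw [h1]
  apply le_antisymm
  · calc μ (A ∩ {x | ℓ x ≤ 0}) ≤ μ (A ∩ {x | ℓ x < 0} ∪ {x | ℓ x = 0}) := by
          apply measure_mono
          rintro x ⟨hxA, hxl⟩
          simp only [mem_setOf_eq] at hxl
          rcases lt_or_eq_of_le hxl with h | h
          · exact Or.inl ⟨hxA, h⟩
          · exact Or.inr h
      _ ≤ μ (A ∩ {x | ℓ x < 0}) + μ {x | ℓ x = 0} := measure_union_le _ _
      _ = μ (A ∩ {x | 0 < ℓ x}) := by
          rw [hnull, add_zero, h2, hσ.measure_preimage hAP.nullMeasurableSet]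
  · rw [← hσ.measure_preimage hAP.nullMeasurableSet, ← h2]
    refine measure_mono fun x hx => ⟨hx.1, ?_⟩
    simp only [mem_setOf_eq] at hx ⊢
    exact hx.2.le

/-- **Overlap of a symmetric sublevel interval with its translate.** If `g : ℝ → ℝ` is monotone in
`|τ|` and `δ ≥ 0` then `vol{τ : g τ < c ∧ g (τ − δ) < c} = vol{t > δ : g (t/2) < c}` (both equal
`(2τ₀ − δ)₊` when `{g < c} = (−τ₀, τ₀)`): split at `τ = δ/2`, reflect the left part by `τ ↦ δ − τ`,
rescale by `2`. This is the step "`‖Y(t−δ)‖ > ‖Y(t)‖ iff t < δ/2`" of [LovasAndai2017, App. A].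
[cite: LovasAndai2017, App. A] -/
theorem volume_overlap_shift (g : ℝ → ℝ) (hg : Measurable g)
    (hsym : ∀ x y, |x| ≤ |y| → g x ≤ g y) (c δ : ℝ) (hδ : 0 ≤ δ) :
    volume {τ : ℝ | g τ < c ∧ g (τ - δ) < c} = volume {t : ℝ | δ < t ∧ g (t / 2) < c} := by
  set E := {τ : ℝ | g τ < c ∧ g (τ - δ) < c} with hE
  set A := {τ : ℝ | δ / 2 < τ ∧ g τ < c} with hA
  set A' := {τ : ℝ | δ / 2 ≤ τ ∧ g τ < c} with hA'
  have hmA' : MeasurableSet A' :=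
    (measurableSet_le measurable_const measurable_id).inter (measurableSet_lt hg measurable_const)
  have h1 : E ∩ Ioi (δ / 2) = A := by
    ext τ
    simp only [hE, hA, mem_inter_iff, mem_setOf_eq, mem_Ioi]
    constructor
    · rintro ⟨⟨h, -⟩, hτ⟩; exact ⟨hτ, h⟩
    · rintro ⟨hτ, h⟩
      refine ⟨⟨h, lt_of_le_of_lt (hsym _ _ ?_) h⟩, hτ⟩
      rw [abs_le]; constructor <;> cases abs_cases τ <;> linarith
  have h2 : E \ Ioi (δ / 2) = (fun τ => δ - τ) ⁻¹' A' := by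
    ext τ
    simp only [hE, hA', mem_sdiff, mem_setOf_eq, mem_Ioi, not_lt, mem_preimage]
    constructor
    · rintro ⟨⟨-, h⟩, hτ⟩
      refine ⟨by linarith, lt_of_le_of_lt (hsym _ _ ?_) h⟩
      rw [show δ - τ = -(τ - δ) by ring, abs_neg]
    · rintro ⟨hτ, h⟩
      refine ⟨⟨lt_of_le_of_lt (hsym _ _ ?_) h, lt_of_le_of_lt (hsym _ _ ?_) h⟩, by linarith⟩
      · rw [abs_le]; constructor <;> cases abs_cases (δ - τ) <;> linarith
      · rw [show τ - δ = -(δ - τ) by ring, abs_neg]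
  have h3 : volume A' = volume A := by
    apply le_antisymm
    · calc volume A' ≤ volume (A ∪ {δ / 2}) := by
            apply measure_mono
            intro τ hτ
            rcases eq_or_lt_of_le hτ.1 with h | h
            · right; exact h.symm
            · left; exact ⟨h, hτ.2⟩
        _ ≤ volume A + volume ({δ / 2} : Set ℝ) := measure_union_le _ _
        _ = volume A := by rw [Real.volume_singleton, add_zero]
    · exact measure_mono fun τ hτ => ⟨hτ.1.le, hτ.2⟩
  have hE_meas : volume E = 2 * volume A := by
    rw [← measure_inter_add_sdiff E (measurableSet_Ioi (a := δ / 2)), h1, h2,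
      (Measure.measurePreserving_sub_left volume δ).measure_preimage hmA'.nullMeasurableSet, h3,
      two_mul]
  have h4 : {t : ℝ | δ < t ∧ g (t / 2) < c} = (fun t => (2:ℝ)⁻¹ * t) ⁻¹' A := by
    ext t
    simp only [hA, mem_setOf_eq, mem_preimage]
    constructor
    · rintro ⟨ht, h⟩; exact ⟨by linarith, by rw [inv_mul_eq_div]; exact h⟩
    · rintro ⟨ht, h⟩; exact ⟨by linarith, by rw [inv_mul_eq_div] at h; exact h⟩
  rw [hE_meas, h4, Real.volume_preimage_mul_left (by norm_num)]
  norm_num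


/-! ### Step 1: regrouping; the set in `ℝ² × ℝ²` -/

/-- Measurability of the regrouped set
`T_δ = {((a,d),(b,c)) : N(a,b,c,d) < 2 ∧ N(a, e^{-δ}b, e^{δ}c, d) < 2}`. [folklore] -/
theorem measurableSet_regrouped (δ : ℝ) :
    MeasurableSet {p : (ℝ × ℝ) × (ℝ × ℝ) | twiceOpNorm p.1.1 p.2.1 p.2.2 p.1.2 < 2 ∧
      twiceOpNorm p.1.1 (Real.exp (-δ) * p.2.1) (p.2.2 / Real.exp (-δ)) p.1.2 < 2} := by
  refine (IsOpen.inter ?_ ?_).measurableSet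
  · exact isOpen_lt (continuous_twiceOpNorm_comp (by fun_prop) (by fun_prop) (by fun_prop)
      (by fun_prop)) continuous_const
  · exact isOpen_lt (continuous_twiceOpNorm_comp (by fun_prop) (by fun_prop) (by fun_prop)
      (by fun_prop)) continuous_const

/-- `normSet (e^{-δ})` is the preimage of the regrouped set under `regroup₂`. [folklore] -/
theorem normSet_eq_preimage (δ : ℝ) :
    normSet (Real.exp (-δ)) = regroup₂ ⁻¹' {p : (ℝ × ℝ) × (ℝ × ℝ) |
      twiceOpNorm p.1.1 p.2.1 p.2.2 p.1.2 < 2 ∧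
      twiceOpNorm p.1.1 (Real.exp (-δ) * p.2.1) (p.2.2 / Real.exp (-δ)) p.1.2 < 2} := by
  ext z
  simp only [normSet, mem_setOf_eq, mem_preimage, regroup₂_apply]

/-! ### Step 2: the two reflections (factor `4`) -/

/-- `vol(T_δ) = 4 · vol(T_δ ∩ {c > 0} ∩ {b > 0})` by the reflections `(b,c) ↦ (−b,−c)` and
`(b,d) ↦ (−b,−d)`, both of which preserve `N` and the similarity. [folklore] -/
theorem volume_regrouped_eq_four_mul (δ : ℝ) :
    volume {p : (ℝ × ℝ) × (ℝ × ℝ) | twiceOpNorm p.1.1 p.2.1 p.2.2 p.1.2 < 2 ∧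
      twiceOpNorm p.1.1 (Real.exp (-δ) * p.2.1) (p.2.2 / Real.exp (-δ)) p.1.2 < 2}
    = 4 * volume ({p : (ℝ × ℝ) × (ℝ × ℝ) | twiceOpNorm p.1.1 p.2.1 p.2.2 p.1.2 < 2 ∧
      twiceOpNorm p.1.1 (Real.exp (-δ) * p.2.1) (p.2.2 / Real.exp (-δ)) p.1.2 < 2}
        ∩ {p | 0 < p.2.2} ∩ {p | 0 < p.2.1}) := by
  set T := {p : (ℝ × ℝ) × (ℝ × ℝ) | twiceOpNorm p.1.1 p.2.1 p.2.2 p.1.2 < 2 ∧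
      twiceOpNorm p.1.1 (Real.exp (-δ) * p.2.1) (p.2.2 / Real.exp (-δ)) p.1.2 < 2} with hT
  have hTm : MeasurableSet T := measurableSet_regrouped δ
  -- first reflection: `(b, c) ↦ (-b, -c)`
  have hσ₁ : MeasurePreserving (Prod.map (id : ℝ × ℝ → ℝ × ℝ) (Neg.neg : ℝ × ℝ → ℝ × ℝ))
      volume volume := by
    have h := (MeasurePreserving.id (volume : Measure (ℝ × ℝ))).prod
      (Measure.measurePreserving_neg (volume : Measure (ℝ × ℝ)))
    rwa [← Measure.volume_eq_prod] at h
  have hnull₁ : volume {p : (ℝ × ℝ) × (ℝ × ℝ) | p.2.2 = 0} = 0 := by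
    have : {p : (ℝ × ℝ) × (ℝ × ℝ) | p.2.2 = 0}
        = (univ : Set (ℝ × ℝ)) ×ˢ ((univ : Set ℝ) ×ˢ ({0} : Set ℝ)) := by
      ext p; simp
    rw [this, Measure.volume_eq_prod, Measure.prod_prod, Measure.volume_eq_prod, Measure.prod_prod]
    simp
  have step₁ : volume T = 2 * volume (T ∩ {p | 0 < p.2.2}) := by
    refine measure_eq_two_mul_of_symm volume hTm (by fun_prop) hnull₁ hσ₁ ?_ ?_
    · intro p
      simp only [hT, mem_setOf_eq, Prod.map_fst, Prod.map_snd, id_eq, Prod.fst_neg, Prod.snd_neg,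
        mul_neg, neg_div, twiceOpNorm_neg_neg]
    · intro p; simp
  -- second reflection: `(b, d) ↦ (-b, -d)`
  have hσ₂ : MeasurePreserving
      (Prod.map (Prod.map (id : ℝ → ℝ) (Neg.neg : ℝ → ℝ)) (Prod.map (Neg.neg : ℝ → ℝ) (id : ℝ → ℝ)))
      volume volume := by
    have ha := ((MeasurePreserving.id (volume : Measure ℝ)).prod
      (Measure.measurePreserving_neg (volume : Measure ℝ)))
    have hb := ((Measure.measurePreserving_neg (volume : Measure ℝ)).prod
      (MeasurePreserving.id (volume : Measure ℝ)))
    rw [← Measure.volume_eq_prod] at ha hb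
    have h := ha.prod hb
    rwa [← Measure.volume_eq_prod] at h
  have hnull₂ : volume {p : (ℝ × ℝ) × (ℝ × ℝ) | p.2.1 = 0} = 0 := by
    have : {p : (ℝ × ℝ) × (ℝ × ℝ) | p.2.1 = 0}
        = (univ : Set (ℝ × ℝ)) ×ˢ (({0} : Set ℝ) ×ˢ (univ : Set ℝ)) := by
      ext p; simp
    rw [this, Measure.volume_eq_prod, Measure.prod_prod, Measure.volume_eq_prod, Measure.prod_prod]
    simp
  have hTP : MeasurableSet (T ∩ {p | 0 < p.2.2}) :=
    hTm.inter (measurableSet_lt measurable_const (by fun_prop))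
  have step₂ : volume (T ∩ {p | 0 < p.2.2}) = 2 * volume (T ∩ {p | 0 < p.2.2} ∩ {p | 0 < p.2.1}) := by
    refine measure_eq_two_mul_of_symm volume hTP (by fun_prop) hnull₂ hσ₂ ?_ ?_
    · intro p
      simp only [hT, mem_inter_iff, mem_setOf_eq, Prod.map_fst, Prod.map_snd, id_eq, mul_neg,
        twiceOpNorm_negb_negd]
    · intro p; simp
  rw [step₁, step₂, ← mul_assoc]
  norm_num

/-! ### Step 3: the off-diagonal section through the hyperbolic chart -/

/-- For fixed diagonal entries `x = (a, d)`, the section of `T_δ ∩ {c > 0} ∩ {b > 0}` is the part of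
the off-diagonal fibre in the open quadrant, whose volume — through the hyperbolic chart and the
overlap lemma — is `∫⁻ m, vol{t : m > 0 ∧ t > δ ∧ hypNorm a d m (t/2) < 2}`.
[cite: LovasAndai2017, App. A] -/
theorem volume_section_eq (δ : ℝ) (hδ : 0 ≤ δ) (x : ℝ × ℝ) :
    volume (Prod.mk x ⁻¹' ({p : (ℝ × ℝ) × (ℝ × ℝ) | twiceOpNorm p.1.1 p.2.1 p.2.2 p.1.2 < 2 ∧
      twiceOpNorm p.1.1 (Real.exp (-δ) * p.2.1) (p.2.2 / Real.exp (-δ)) p.1.2 < 2}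
        ∩ {p | 0 < p.2.2} ∩ {p | 0 < p.2.1}))
    = ∫⁻ m : ℝ, volume {t : ℝ | 0 < m ∧ δ < t ∧ hypNorm x.1 x.2 m (t / 2) < 2} := by
  -- the fibre and its quadrant part
  set fib := {y : ℝ × ℝ | twiceOpNorm x.1 y.1 y.2 x.2 < 2 ∧
      twiceOpNorm x.1 (Real.exp (-δ) * y.1) (y.2 / Real.exp (-δ)) x.2 < 2} with hfib
  have hfibm : MeasurableSet fib := by
    refine (IsOpen.inter ?_ ?_).measurableSet
    · exact isOpen_lt (continuous_twiceOpNorm_comp (by fun_prop) (by fun_prop) (by fun_prop)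
        (by fun_prop)) continuous_const
    · exact isOpen_lt (continuous_twiceOpNorm_comp (by fun_prop) (by fun_prop) (by fun_prop)
        (by fun_prop)) continuous_const
  have hsec : Prod.mk x ⁻¹' ({p : (ℝ × ℝ) × (ℝ × ℝ) | twiceOpNorm p.1.1 p.2.1 p.2.2 p.1.2 < 2 ∧
      twiceOpNorm p.1.1 (Real.exp (-δ) * p.2.1) (p.2.2 / Real.exp (-δ)) p.1.2 < 2}
        ∩ {p | 0 < p.2.2} ∩ {p | 0 < p.2.1}) = fib ∩ {y | 0 < y.1 ∧ 0 < y.2} := by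
    ext y
    simp only [hfib, mem_preimage, mem_inter_iff, mem_setOf_eq]
    tauto
  rw [hsec, volume_inter_quadrant fib hfibm]
  -- in the chart
  have hchart : {w : ℝ × ℝ | 0 < w.1 ∧ hypChart w ∈ fib}
      = {w : ℝ × ℝ | 0 < w.1 ∧ hypNorm x.1 x.2 w.1 w.2 < 2 ∧ hypNorm x.1 x.2 w.1 (w.2 - δ) < 2} := by
    ext w
    simp only [hfib, mem_setOf_eq, hypChart, twiceOpNorm_conj_hypChart, hypNorm]
  rw [hchart]
  have hg1 : Measurable fun w : ℝ × ℝ => hypNorm x.1 x.2 w.1 w.2 :=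
    (continuous_hypNorm_comp continuous_const continuous_const continuous_fst
      continuous_snd).measurable
  have hg2 : Measurable fun w : ℝ × ℝ => hypNorm x.1 x.2 w.1 (w.2 - δ) :=
    (continuous_hypNorm_comp continuous_const continuous_const continuous_fst
      (continuous_snd.sub continuous_const)).measurable
  have hWm : MeasurableSet
      {w : ℝ × ℝ | 0 < w.1 ∧ hypNorm x.1 x.2 w.1 w.2 < 2 ∧ hypNorm x.1 x.2 w.1 (w.2 - δ) < 2} := by
    change MeasurableSet ({w : ℝ × ℝ | 0 < w.1} ∩ ({w | hypNorm x.1 x.2 w.1 w.2 < 2}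
      ∩ {w | hypNorm x.1 x.2 w.1 (w.2 - δ) < 2}))
    exact (measurableSet_lt measurable_const measurable_fst).inter
      ((measurableSet_lt hg1 measurable_const).inter (measurableSet_lt hg2 measurable_const))
  rw [Measure.volume_eq_prod, Measure.prod_apply hWm]
  refine lintegral_congr fun m => ?_
  have hpre : Prod.mk m ⁻¹'
      {w : ℝ × ℝ | 0 < w.1 ∧ hypNorm x.1 x.2 w.1 w.2 < 2 ∧ hypNorm x.1 x.2 w.1 (w.2 - δ) < 2}
      = {τ : ℝ | 0 < m ∧ hypNorm x.1 x.2 m τ < 2 ∧ hypNorm x.1 x.2 m (τ - δ) < 2} := by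
    ext τ; simp
  rw [hpre]
  rcases le_or_gt m 0 with hm | hm
  · have e1 : {τ : ℝ | 0 < m ∧ hypNorm x.1 x.2 m τ < 2 ∧ hypNorm x.1 x.2 m (τ - δ) < 2} = ∅ := by
      ext τ; simp only [mem_setOf_eq, mem_empty_iff_false, iff_false, not_and]; intro h; linarith
    have e2 : {t : ℝ | 0 < m ∧ δ < t ∧ hypNorm x.1 x.2 m (t / 2) < 2} = ∅ := by
      ext τ; simp only [mem_setOf_eq, mem_empty_iff_false, iff_false, not_and]; intro h; linarith
    rw [e1, e2]
  · have e1 : {τ : ℝ | 0 < m ∧ hypNorm x.1 x.2 m τ < 2 ∧ hypNorm x.1 x.2 m (τ - δ) < 2}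
        = {τ : ℝ | hypNorm x.1 x.2 m τ < 2 ∧ hypNorm x.1 x.2 m (τ - δ) < 2} := by
      ext τ; simp [hm]
    have e2 : {t : ℝ | 0 < m ∧ δ < t ∧ hypNorm x.1 x.2 m (t / 2) < 2}
        = {t : ℝ | δ < t ∧ hypNorm x.1 x.2 m (t / 2) < 2} := by
      ext τ; simp [hm]
    rw [e1, e2]
    exact volume_overlap_shift (hypNorm x.1 x.2 m)
      (continuous_hypNorm_comp continuous_const continuous_const continuous_const
        continuous_id).measurable
      (fun _ _ h => hypNorm_mono_abs x.1 x.2 hm.le h) 2 δ hδ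

/-! ### Step 4: Tonelli -/

/-- Measurability of `E_δ = {(((a,d),m),t) : m > 0 ∧ t > δ ∧ hypNorm a d m (t/2) < 2}`. [folklore] -/
theorem measurableSet_E (δ : ℝ) :
    MeasurableSet {q : ((ℝ × ℝ) × ℝ) × ℝ |
      0 < q.1.2 ∧ δ < q.2 ∧ hypNorm q.1.1.1 q.1.1.2 q.1.2 (q.2 / 2) < 2} := by
  have h1 : Measurable fun q : ((ℝ × ℝ) × ℝ) × ℝ => q.1.2 := by fun_prop
  have h2 : Measurable fun q : ((ℝ × ℝ) × ℝ) × ℝ => q.2 := by fun_prop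
  have h3 : Measurable fun q : ((ℝ × ℝ) × ℝ) × ℝ => hypNorm q.1.1.1 q.1.1.2 q.1.2 (q.2 / 2) :=
    (continuous_hypNorm_comp (by fun_prop) (by fun_prop) (by fun_prop) (by fun_prop)).measurable
  change MeasurableSet ({q : ((ℝ × ℝ) × ℝ) × ℝ | 0 < q.1.2} ∩ ({q | δ < q.2}
    ∩ {q | hypNorm q.1.1.1 q.1.1.2 q.1.2 (q.2 / 2) < 2}))
  exact (measurableSet_lt measurable_const h1).inter
    ((measurableSet_lt measurable_const h2).inter (measurableSet_lt h3 measurable_const))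

/-- **Lovas–Andai Lemma 6, reduction step.** For `δ ≥ 0`,
`vol(normSet (e^{-δ})) = 4 ∫⁻_{t > δ} ∫⁻_{(a,d)} vol{m > 0 : hypNorm a d m (t/2) < 2} dt`:
the four-dimensional volume `χ₁(e^{-δ})` as a one-dimensional integral, over the translation
parameter, of the volume of a three-dimensional section. [cite: LovasAndai2017, Lemma 6 and App. A] -/
theorem volume_normSet_exp_neg (δ : ℝ) (hδ : 0 ≤ δ) :
    volume (normSet (Real.exp (-δ)))
      = 4 * ∫⁻ t in Ioi δ, ∫⁻ x : ℝ × ℝ, volume {m : ℝ | 0 < m ∧ hypNorm x.1 x.2 m (t / 2) < 2} := by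
  rw [normSet_eq_preimage, measurePreserving_regroup₂.measure_preimage_equiv,
    volume_regrouped_eq_four_mul]
  congr 1
  have hTm := measurableSet_regrouped δ
  have hSm : MeasurableSet ({p : (ℝ × ℝ) × (ℝ × ℝ) | twiceOpNorm p.1.1 p.2.1 p.2.2 p.1.2 < 2 ∧
      twiceOpNorm p.1.1 (Real.exp (-δ) * p.2.1) (p.2.2 / Real.exp (-δ)) p.1.2 < 2}
        ∩ {p | 0 < p.2.2} ∩ {p | 0 < p.2.1}) :=
    (hTm.inter (measurableSet_lt measurable_const (by fun_prop))).inter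
      (measurableSet_lt measurable_const (by fun_prop))
  rw [Measure.volume_eq_prod, Measure.prod_apply hSm]
  simp_rw [volume_section_eq δ hδ]
  -- now everything is an iterated integral of the indicator of `E`
  set E := {q : ((ℝ × ℝ) × ℝ) × ℝ |
      0 < q.1.2 ∧ δ < q.2 ∧ hypNorm q.1.1.1 q.1.1.2 q.1.2 (q.2 / 2) < 2} with hE
  have hEm : MeasurableSet E := measurableSet_E δ
  set F : ((ℝ × ℝ) × ℝ) × ℝ → ℝ≥0∞ := E.indicator 1 with hF
  have hFm : Measurable F := measurable_one.indicator hEm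
  -- inner volumes as integrals of `F`
  have hin : ∀ (x : ℝ × ℝ) (m : ℝ),
      volume {t : ℝ | 0 < m ∧ δ < t ∧ hypNorm x.1 x.2 m (t / 2) < 2} = ∫⁻ t, F ((x, m), t) := by
    intro x m
    have hmeas : MeasurableSet {t : ℝ | 0 < m ∧ δ < t ∧ hypNorm x.1 x.2 m (t / 2) < 2} := by
      change MeasurableSet ({t : ℝ | 0 < m} ∩ ({t | δ < t} ∩ {t | hypNorm x.1 x.2 m (t / 2) < 2}))
      exact (measurableSet_lt measurable_const measurable_const).inter
        ((measurableSet_lt measurable_const measurable_id).inter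
          (measurableSet_lt ((continuous_hypNorm_comp continuous_const continuous_const
            continuous_const (continuous_id.div_const _)).measurable) measurable_const))
    rw [← lintegral_indicator_one hmeas]
    rfl
  simp_rw [hin]
  -- combine `(x, m)` and swap with `t`
  have h1 : ∫⁻ x : ℝ × ℝ, ∫⁻ m : ℝ, ∫⁻ t : ℝ, F ((x, m), t)
      = ∫⁻ y : (ℝ × ℝ) × ℝ, ∫⁻ t : ℝ, F (y, t) := by
    rw [Measure.volume_eq_prod ((ℝ × ℝ)) ℝ, lintegral_prod]
    exact (hFm.lintegral_prod_right').aemeasurable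
  have h2 : ∫⁻ y : (ℝ × ℝ) × ℝ, ∫⁻ t : ℝ, F (y, t) = ∫⁻ t : ℝ, ∫⁻ y : (ℝ × ℝ) × ℝ, F (y, t) :=
    lintegral_lintegral_swap hFm.aemeasurable
  have h3 : ∀ t : ℝ, ∫⁻ y : (ℝ × ℝ) × ℝ, F (y, t) = ∫⁻ x : ℝ × ℝ, ∫⁻ m : ℝ, F ((x, m), t) := by
    intro t
    rw [Measure.volume_eq_prod ((ℝ × ℝ)) ℝ, lintegral_prod]
    exact (hFm.comp (measurable_id.prodMk measurable_const)).aemeasurable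
  rw [h1, h2]
  simp_rw [h3]
  -- identify the `t`-integrand with the indicator of `Ioi δ`
  rw [← lintegral_indicator measurableSet_Ioi]
  refine lintegral_congr fun t => ?_
  by_cases ht : δ < t
  · rw [indicator_of_mem (mem_Ioi.mpr ht)]
    refine lintegral_congr fun x => ?_
    have hmeas : MeasurableSet {m : ℝ | 0 < m ∧ hypNorm x.1 x.2 m (t / 2) < 2} := by
      change MeasurableSet ({m : ℝ | 0 < m} ∩ {m | hypNorm x.1 x.2 m (t / 2) < 2})
      exact (measurableSet_lt measurable_const measurable_id).inter
        (measurableSet_lt ((continuous_hypNorm_comp continuous_const continuous_const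
            continuous_id continuous_const).measurable) measurable_const)
    rw [← lintegral_indicator_one hmeas]
    refine lintegral_congr fun m => ?_
    simp only [hF, hE, indicator, mem_setOf_eq, ht, true_and, Pi.one_apply]
  · rw [indicator_of_notMem (by simpa using ht)]
    have : ∀ (x : ℝ × ℝ) (m : ℝ), F ((x, m), t) = 0 := by
      intro x m
      simp only [hF, hE, indicator, mem_setOf_eq, ht, false_and, and_false, if_false]
    simp_rw [this, lintegral_zero]

/-! ## Part B: the closed form -/

/-! ### The `m`-sections -/

/-- For `t ≠ 0`, `m ↦ hypNorm a d m (t/2)` is strictly increasing on `[0, ∞)`. [folklore] -/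
theorem hypNorm_half_strictMonoOn (a d : ℝ) {t : ℝ} (ht : t ≠ 0) :
    StrictMonoOn (fun m => hypNorm a d m (t / 2)) (Ici 0) := by
  intro m₁ hm₁ m₂ hm₂ hlt
  simp only [mem_Ici] at hm₁ hm₂
  simp only [hypNorm_half a d hm₁, hypNorm_half a d hm₂]
  have hC : 1 < cosh t := Real.one_lt_cosh.mpr ht
  gcongr √(_ + ?_) + √(_ + ?_) <;> nlinarith

/-- The explicit root: for `t > 0`, `|a|, |d| < 1`, `m* = mStar a d t` is positive, at most `1 + ad`,
and `hypNorm a d m* (t/2) = 2`. [cite: LovasAndai2017, App. A] -/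
theorem hypNorm_mStar {a d t : ℝ} (ht : 0 < t) (ha : |a| < 1) (hd : |d| < 1) :
    0 < mStar a d t ∧ mStar a d t ≤ 1 + a * d ∧ hypNorm a d (mStar a d t) (t / 2) = 2 := by
  set C := cosh t with hC
  set S := sinh t with hS
  have hC1 : 1 < C := Real.one_lt_cosh.mpr ht.ne'
  have hCS : C ^ 2 - S ^ 2 = 1 := Real.cosh_sq_sub_sinh_sq t
  have ha' := abs_lt.mp ha
  have hd' := abs_lt.mp hd
  have hA : 0 < 1 - a ^ 2 := by nlinarith
  have hDd : 0 < 1 - d ^ 2 := by nlinarith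
  have had : |a * d| < 1 := by
    rw [abs_mul]; exact mul_lt_one_of_nonneg_of_lt_one_left (abs_nonneg _) ha hd.le
  have had' := abs_lt.mp had
  set D := S ^ 2 + a ^ 2 + d ^ 2 + 2 * a * d * C with hD
  have hD0 : 0 ≤ D := by
    have : D = S ^ 2 * (1 - d ^ 2) + (a + d * C) ^ 2 := by
      rw [hD]; linear_combination (-d ^ 2) * hCS
    rw [this]; positivity
  set R := √D with hR
  have hR0 : 0 ≤ R := Real.sqrt_nonneg _
  have hR2 : R ^ 2 = D := Real.sq_sqrt hD0
  have hm : mStar a d t = C + a * d - R := rfl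
  have hquad : (mStar a d t) ^ 2 - 2 * (mStar a d t) * (a * d + C) + (1 - a ^ 2) * (1 - d ^ 2)
      = 0 := by
    rw [hm]; linear_combination hR2 + hD - hCS
  have hpos : 0 < mStar a d t := by
    rw [hm]
    have hadC : 0 < a * d + C := by linarith
    have hdiff : (a * d + C) ^ 2 - D = (1 - a ^ 2) * (1 - d ^ 2) := by
      rw [hD]; linear_combination hCS
    have hR2' : R ^ 2 < (a * d + C) ^ 2 := by nlinarith [mul_pos hA hDd]
    have : R < a * d + C := lt_of_pow_lt_pow_left₀ 2 hadC.le hR2'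
    linarith
  have hup : mStar a d t ≤ 1 + a * d := by
    rw [hm]
    have hdiff : D - (C - 1) ^ 2 = (a + d) ^ 2 + 2 * (C - 1) * (1 + a * d) := by
      rw [hD]; linear_combination (-1 : ℝ) * hCS
    have hsq : (C - 1) ^ 2 ≤ R ^ 2 := by
      rw [hR2]
      nlinarith [sq_nonneg (a + d), mul_nonneg (sub_nonneg.mpr hC1.le)
        (by linarith : (0:ℝ) ≤ 1 + a * d)]
    have : C - 1 ≤ R := le_of_pow_le_pow_left₀ two_ne_zero hR0 hsq
    linarith
  refine ⟨hpos, hup, ?_⟩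
  rw [hypNorm_half a d hpos.le]
  have e1 : √((a + d) ^ 2 + 2 * mStar a d t * (C - 1)) = 1 + a * d - mStar a d t := by
    rw [Real.sqrt_eq_cases]; left
    constructor
    · linear_combination hquad
    · linarith
  have e2 : √((a - d) ^ 2 + 2 * mStar a d t * (C + 1)) = 1 - a * d + mStar a d t := by
    rw [Real.sqrt_eq_cases]; left
    constructor
    · linear_combination hquad
    · linarith
  rw [e1, e2]; ring

/-- The `m`-section is the interval `(0, m*)` when `|a|, |d| < 1` (`t > 0`).
[cite: LovasAndai2017, App. A] -/
theorem mSection_eq_Ioo {a d t : ℝ} (ht : 0 < t) (ha : |a| < 1) (hd : |d| < 1) :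
    {m : ℝ | 0 < m ∧ hypNorm a d m (t / 2) < 2} = Ioo 0 (mStar a d t) := by
  obtain ⟨hpos, -, heq⟩ := hypNorm_mStar ht ha hd
  have hmono := hypNorm_half_strictMonoOn a d ht.ne'
  ext m
  simp only [mem_setOf_eq, mem_Ioo]
  constructor
  · rintro ⟨hm, h⟩
    refine ⟨hm, ?_⟩
    by_contra hcon
    push Not at hcon
    have := hmono.monotoneOn (by simpa using hpos.le) (by simpa using hm.le) hcon
    linarith
  · rintro ⟨hm, h⟩
    refine ⟨hm, ?_⟩
    have := hmono (by simpa using hm.le) (by simpa using hpos.le) h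
    linarith

/-- The `m`-section is empty when `|a| ≥ 1` or `|d| ≥ 1` (as `hypNorm ≥ |a+d| + |a−d| ≥ 2`).
[folklore] -/
theorem mSection_eq_empty {a d t : ℝ} (had : 1 ≤ |a| ∨ 1 ≤ |d|) :
    {m : ℝ | 0 < m ∧ hypNorm a d m (t / 2) < 2} = ∅ := by
  ext m
  simp only [mem_setOf_eq, mem_empty_iff_false, iff_false, not_and, not_lt]
  intro _
  refine le_trans ?_ (abs_add_abs_le_hypNorm _ _ _ _)
  have h1 : 2 * |a| ≤ |a + d| + |a - d| := by
    have := abs_add_le (a + d) (a - d)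
    rwa [show (a + d) + (a - d) = 2 * a by ring, abs_mul, abs_two] at this
  have h2 : 2 * |d| ≤ |a + d| + |a - d| := by
    have := abs_sub (a + d) (a - d)
    rwa [show (a + d) - (a - d) = 2 * d by ring, abs_mul, abs_two] at this
  rcases had with h | h <;> linarith

/-- Volume of the `m`-section: the indicator of the open square `(-1,1)²` times `m*`. [folklore] -/
theorem volume_mSection {t : ℝ} (ht : 0 < t) (x : ℝ × ℝ) :
    volume {m : ℝ | 0 < m ∧ hypNorm x.1 x.2 m (t / 2) < 2}
      = (Ioo (-1:ℝ) 1 ×ˢ Ioo (-1:ℝ) 1).indicator (fun x => ENNReal.ofReal (mStar x.1 x.2 t)) x := by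
  by_cases hx : x ∈ Ioo (-1:ℝ) 1 ×ˢ Ioo (-1:ℝ) 1
  · rw [indicator_of_mem hx]
    obtain ⟨⟨ha1, ha2⟩, ⟨hd1, hd2⟩⟩ := hx
    rw [mSection_eq_Ioo ht (abs_lt.mpr ⟨ha1, ha2⟩) (abs_lt.mpr ⟨hd1, hd2⟩), Real.volume_Ioo,
      sub_zero]
  · rw [indicator_of_notMem hx]
    have had : 1 ≤ |x.1| ∨ 1 ≤ |x.2| := by
      by_contra hcon
      push Not at hcon
      exact hx ⟨abs_lt.mp hcon.1, abs_lt.mp hcon.2⟩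
    rw [mSection_eq_empty had, measure_empty]

/-! ### The explicit integrals -/

/-- The primitive of `√(u² + k²)`: `(u√(u²+k²) + k² log(u + √(u²+k²)))/2` (`k > 0`). [folklore] -/
theorem hasDerivAt_sqrtAntideriv {k : ℝ} (hk : 0 < k) (u : ℝ) :
    HasDerivAt (fun u => (u * √(u ^ 2 + k ^ 2) + k ^ 2 * Real.log (u + √(u ^ 2 + k ^ 2))) / 2)
      (√(u ^ 2 + k ^ 2)) u := by
  set w := √(u ^ 2 + k ^ 2) with hw
  have hpos : 0 < u ^ 2 + k ^ 2 := by positivity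
  have hw0 : 0 < w := Real.sqrt_pos.mpr hpos
  have hw2 : w ^ 2 = u ^ 2 + k ^ 2 := Real.sq_sqrt hpos.le
  have huw : 0 < u + w := by
    have habs : |u| < w := by
      rw [← Real.sqrt_sq_eq_abs]
      exact Real.sqrt_lt_sqrt (sq_nonneg _) (by nlinarith)
    linarith [neg_abs_le u]
  have h1 : HasDerivAt (fun u => √(u ^ 2 + k ^ 2)) (u / w) u := by
    have := ((hasDerivAt_pow 2 u).add_const (k ^ 2)).sqrt hpos.ne'
    convert this using 1
    rw [← hw]; field_simp; ring
  have h2 : HasDerivAt (fun u => u * √(u ^ 2 + k ^ 2)) (1 * w + u * (u / w)) u :=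
    (hasDerivAt_id u).mul h1
  have h3 : HasDerivAt (fun u => Real.log (u + √(u ^ 2 + k ^ 2))) ((1 + u / w) / (u + w)) u := by
    have := ((hasDerivAt_id u).add h1).log huw.ne'
    simpa using this
  have h4 := (h2.add (h3.const_mul (k ^ 2))).div_const 2
  refine h4.congr_deriv ?_
  field_simp
  nlinarith [hw2]

/-- `∫_{-1}^{1} √(S² + a² + d² + 2adC) dd = C(1 + a²) + (S²(1 − a²)/2)·log((C+1)/(C−1))` for
`C² − S² = 1`, `C > 1`, `|a| < 1`: the endpoint values of the primitive are explicit because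
`√((aC ± 1)² + S²(1−a²)) = C ± a`. [cite: LovasAndai2017, App. A] -/
theorem integral_sqrt_inner {C S a : ℝ} (hCS : C ^ 2 - S ^ 2 = 1) (hC : 1 < C) (ha : |a| < 1) :
    ∫ d in (-1:ℝ)..1, √(S ^ 2 + a ^ 2 + d ^ 2 + 2 * a * d * C)
      = C * (1 + a ^ 2) + S ^ 2 * (1 - a ^ 2) / 2 * Real.log ((C + 1) / (C - 1)) := by
  have ha1 : 0 < 1 - a ^ 2 := by nlinarith [abs_nonneg a, sq_abs a, abs_lt.mp ha]
  have hS2 : 0 < S ^ 2 := by nlinarith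
  set k := √(S ^ 2 * (1 - a ^ 2)) with hk
  have hk0 : 0 < k := Real.sqrt_pos.mpr (by positivity)
  have hk2 : k ^ 2 = S ^ 2 * (1 - a ^ 2) := Real.sq_sqrt (by positivity)
  have hrad : ∀ d, S ^ 2 + a ^ 2 + d ^ 2 + 2 * a * d * C = (d + a * C) ^ 2 + k ^ 2 := by
    intro d; rw [hk2]; linear_combination (-(a ^ 2)) * hCS
  simp_rw [hrad]
  set F : ℝ → ℝ := fun u => (u * √(u ^ 2 + k ^ 2) + k ^ 2 * Real.log (u + √(u ^ 2 + k ^ 2))) / 2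
  have hderiv : ∀ d, HasDerivAt (fun d => F (d + a * C)) (√((d + a * C) ^ 2 + k ^ 2)) d := by
    intro d
    have := (hasDerivAt_sqrtAntideriv hk0 (d + a * C)).comp d ((hasDerivAt_id d).add_const (a * C))
    rw [mul_one] at this
    exact this
  rw [intervalIntegral.integral_eq_sub_of_hasDerivAt (fun d _ => hderiv d)
    ((Continuous.intervalIntegrable (by fun_prop) _ _))]
  have ha' := abs_lt.mp ha
  have e1 : √((1 + a * C) ^ 2 + k ^ 2) = C + a := by
    rw [Real.sqrt_eq_cases]; left
    constructor
    · rw [hk2]; linear_combination (1 - a ^ 2) * hCS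
    · nlinarith
  have e2 : √((-1 + a * C) ^ 2 + k ^ 2) = C - a := by
    rw [Real.sqrt_eq_cases]; left
    constructor
    · rw [hk2]; linear_combination (1 - a ^ 2) * hCS
    · nlinarith
  simp only [F, e1, e2]
  have hl1 : 1 + a * C + (C + a) = (1 + a) * (C + 1) := by ring
  have hl2 : -1 + a * C + (C - a) = (1 + a) * (C - 1) := by ring
  have hap : 0 < 1 + a := by linarith
  rw [hl1, hl2, Real.log_mul hap.ne' (by linarith), Real.log_mul hap.ne' (by linarith),
    Real.log_div (by linarith) (by linarith), hk2]
  ring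

/-- The inner integral of `m*`: `∫_{-1}^{1} m*(a, d, t) dd = (1 − a²)(C − (S²/2) log((C+1)/(C−1)))`
for `t > 0`, `|a| < 1`. [cite: LovasAndai2017, App. A] -/
theorem integral_mStar_inner {t a : ℝ} (ht : 0 < t) (ha : |a| < 1) :
    ∫ d in (-1:ℝ)..1, mStar a d t
      = (1 - a ^ 2) * (cosh t - sinh t ^ 2 / 2 * Real.log ((cosh t + 1) / (cosh t - 1))) := by
  have hC : 1 < cosh t := Real.one_lt_cosh.mpr ht.ne'
  have hCS : cosh t ^ 2 - sinh t ^ 2 = 1 := Real.cosh_sq_sub_sinh_sq t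
  unfold mStar
  rw [intervalIntegral.integral_sub (Continuous.intervalIntegrable (by fun_prop) _ _)
      (Continuous.intervalIntegrable (by fun_prop) _ _),
    intervalIntegral.integral_add (Continuous.intervalIntegrable (by fun_prop) _ _)
      (Continuous.intervalIntegrable (by fun_prop) _ _),
    intervalIntegral.integral_const, intervalIntegral.integral_const_mul, integral_id,
    integral_sqrt_inner hCS hC ha]
  ring

/-- The double integral: `∫∫_{(-1,1)²} m* = defectDensity t` (`t > 0`).
[cite: LovasAndai2017, App. A (last display)] -/
theorem setIntegral_mStar {t : ℝ} (ht : 0 < t) :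
    ∫ x in Ioo (-1:ℝ) 1 ×ˢ Ioo (-1:ℝ) 1, mStar x.1 x.2 t = defectDensity t := by
  have hcont : Continuous fun x : ℝ × ℝ => mStar x.1 x.2 t := by unfold mStar; fun_prop
  have hint : IntegrableOn (fun x : ℝ × ℝ => mStar x.1 x.2 t) (Ioo (-1:ℝ) 1 ×ˢ Ioo (-1:ℝ) 1)
      volume :=
    (hcont.continuousOn.integrableOn_compact (isCompact_Icc.prod isCompact_Icc)).mono_set
      (Set.prod_mono Ioo_subset_Icc_self Ioo_subset_Icc_self)
  rw [Measure.volume_eq_prod, setIntegral_prod _ hint]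
  have hinner : ∀ a ∈ Ioo (-1:ℝ) 1, ∫ d in Ioo (-1:ℝ) 1, mStar a d t
      = (1 - a ^ 2) * (cosh t - sinh t ^ 2 / 2 * Real.log ((cosh t + 1) / (cosh t - 1))) := by
    intro a ha
    rw [← integral_Ioc_eq_integral_Ioo, ← intervalIntegral.integral_of_le (by norm_num),
      integral_mStar_inner ht (abs_lt.mpr ha)]
  rw [setIntegral_congr_fun measurableSet_Ioo hinner, ← integral_Ioc_eq_integral_Ioo,
    ← intervalIntegral.integral_of_le (by norm_num), intervalIntegral.integral_mul_const,
    intervalIntegral.integral_sub (Continuous.intervalIntegrable (by fun_prop) _ _)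
      (Continuous.intervalIntegrable (by fun_prop) _ _),
    intervalIntegral.integral_const, integral_pow]
  unfold defectDensity
  norm_num

/-- `m* ≥ 0` on the open square, hence the double integral and `defectDensity t` are nonnegative
(`t > 0`). [folklore] -/
theorem defectDensity_nonneg {t : ℝ} (ht : 0 < t) : 0 ≤ defectDensity t := by
  rw [← setIntegral_mStar ht]
  refine setIntegral_nonneg (measurableSet_Ioo.prod measurableSet_Ioo) fun x hx => ?_
  obtain ⟨⟨ha1, ha2⟩, ⟨hd1, hd2⟩⟩ := hx
  exact (hypNorm_mStar ht (abs_lt.mpr ⟨ha1, ha2⟩) (abs_lt.mpr ⟨hd1, hd2⟩)).1.le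

/-- The three-dimensional section has volume `defectDensity t` (`t > 0`):
`∫⁻_{(a,d)} vol{m > 0 : hypNorm a d m (t/2) < 2} = ofReal (defectDensity t)`.
[cite: LovasAndai2017, App. A] -/
theorem lintegral_volume_mSection {t : ℝ} (ht : 0 < t) :
    ∫⁻ x : ℝ × ℝ, volume {m : ℝ | 0 < m ∧ hypNorm x.1 x.2 m (t / 2) < 2}
      = ENNReal.ofReal (defectDensity t) := by
  simp_rw [volume_mSection ht]
  rw [lintegral_indicator (measurableSet_Ioo.prod measurableSet_Ioo), ← setIntegral_mStar ht,
    ofReal_integral_eq_lintegral_ofReal]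
  · have hcont : Continuous fun x : ℝ × ℝ => mStar x.1 x.2 t := by unfold mStar; fun_prop
    exact (hcont.continuousOn.integrableOn_compact (isCompact_Icc.prod isCompact_Icc)).mono_set
      (Set.prod_mono Ioo_subset_Icc_self Ioo_subset_Icc_self)
  · rw [Filter.EventuallyLE, ae_restrict_iff' (measurableSet_Ioo.prod measurableSet_Ioo)]
    refine Filter.Eventually.of_forall fun x hx => ?_
    obtain ⟨⟨ha1, ha2⟩, ⟨hd1, hd2⟩⟩ := hx
    exact (hypNorm_mStar ht (abs_lt.mpr ⟨ha1, ha2⟩) (abs_lt.mpr ⟨hd1, hd2⟩)).1.le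

/-! ### `χ₁(e^{-δ})` as an integral of the defect density -/

/-- **[LovasAndai2017, App. A, last display] in volume form**: for `δ ≥ 0`,
`vol(normSet (e^{-δ})) = 4 ∫⁻_{t > δ} defectDensity t`, i.e.
`χ₁(e^{-δ}) = (16/3) ∫_δ^∞ (cosh t − sinh² t · log((e^t+1)/(e^t−1))) dt`. [cite: LovasAndai2017, App. A] -/
theorem volume_normSet_eq_lintegral (δ : ℝ) (hδ : 0 ≤ δ) :
    volume (normSet (Real.exp (-δ))) = 4 * ∫⁻ t in Ioi δ, ENNReal.ofReal (defectDensity t) := by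
  rw [volume_normSet_exp_neg δ hδ]
  congr 1
  refine setLIntegral_congr_fun measurableSet_Ioi fun t ht => ?_
  exact lintegral_volume_mSection (lt_of_le_of_lt hδ ht)

/-- `normSet ε ⊆ {N < 2}`, so its volume is at most `2π²/3 < ∞`. [folklore] -/
theorem volume_normSet_lt_top (ε : ℝ) : volume (normSet ε) < ⊤ := by
  calc volume (normSet ε) ≤ volume {z : Fin 4 → ℝ | twiceOpNorm (z 0) (z 1) (z 2) (z 3) < 2} :=
        measure_mono fun z hz => hz.1
    _ = ENNReal.ofReal (2 / 3 * Real.pi ^ 2) := volume_normBall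
    _ < ⊤ := ENNReal.ofReal_lt_top

/-- `defectDensity` is measurable. [folklore] -/
theorem measurable_defectDensity : Measurable defectDensity := by
  unfold defectDensity; fun_prop

/-- `defectDensity` is integrable on `(δ, ∞)` for `δ ≥ 0` (its integral is a finite volume). [folklore] -/
theorem integrableOn_defectDensity (δ : ℝ) (hδ : 0 ≤ δ) : IntegrableOn defectDensity (Ioi δ) := by
  have hnn : 0 ≤ᵐ[volume.restrict (Ioi δ)] defectDensity := by
    rw [Filter.EventuallyLE, ae_restrict_iff' measurableSet_Ioi]
    exact Filter.Eventually.of_forall fun t ht => defectDensity_nonneg (lt_of_le_of_lt hδ ht)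
  refine ⟨measurable_defectDensity.aestronglyMeasurable, ?_⟩
  rw [hasFiniteIntegral_iff_ofReal hnn]
  have h := volume_normSet_eq_lintegral δ hδ
  have hfin := volume_normSet_lt_top (Real.exp (-δ))
  rw [h] at hfin
  exact lt_of_le_of_lt (by
    calc ∫⁻ t in Ioi δ, ENNReal.ofReal (defectDensity t)
        ≤ 4 * ∫⁻ t in Ioi δ, ENNReal.ofReal (defectDensity t) := by
          conv_lhs => rw [← one_mul (∫⁻ t in Ioi δ, ENNReal.ofReal (defectDensity t))]
          gcongr; norm_num) hfin

/-- `vol(normSet (e^{-δ})) = ofReal (4 ∫_{t > δ} defectDensity t)` (`δ ≥ 0`). [cite: LovasAndai2017, App. A] -/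
theorem volume_normSet_eq_integral (δ : ℝ) (hδ : 0 ≤ δ) :
    volume (normSet (Real.exp (-δ))) = ENNReal.ofReal (4 * ∫ t in Ioi δ, defectDensity t) := by
  have hnn : 0 ≤ᵐ[volume.restrict (Ioi δ)] defectDensity := by
    rw [Filter.EventuallyLE, ae_restrict_iff' measurableSet_Ioi]
    exact Filter.Eventually.of_forall fun t ht => defectDensity_nonneg (lt_of_le_of_lt hδ ht)
  rw [volume_normSet_eq_lintegral δ hδ, ENNReal.ofReal_mul (by norm_num),
    ofReal_integral_eq_lintegral_ofReal (integrableOn_defectDensity δ hδ) hnn]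
  norm_num

/-! ### The substitution `s = e^{-t}` -/

/-- `defectDensity (−log s) / s = (2/3)·(s + 1/s − ½(s − 1/s)² log((1+s)/(1−s)))/s` for
`0 < s < 1` (`cosh(log s) = (s + 1/s)/2`, `(cosh + 1)/(cosh − 1) = ((1+s)/(1−s))²`).
[cite: LovasAndai2017, Lemma 6] -/
theorem defectDensity_neg_log {s : ℝ} (hs0 : 0 < s) (hs1 : s < 1) :
    s⁻¹ * defectDensity (-Real.log s)
      = 2 / 3 * ((s + s⁻¹ - (s - s⁻¹) ^ 2 / 2 * Real.log ((1 + s) / (1 - s))) / s) := by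
  unfold defectDensity
  have hc : cosh (-Real.log s) = (s + s⁻¹) / 2 := by
    rw [Real.cosh_neg, Real.cosh_eq, Real.exp_log hs0, Real.exp_neg, Real.exp_log hs0]
  have hsh : sinh (-Real.log s) ^ 2 = (s - s⁻¹) ^ 2 / 4 := by
    rw [Real.sinh_neg, Real.sinh_eq, Real.exp_log hs0, Real.exp_neg, Real.exp_log hs0]; ring
  have hq : ((s + s⁻¹) / 2 + 1) / ((s + s⁻¹) / 2 - 1) = ((1 + s) / (1 - s)) ^ 2 := by
    have h1 : (1 - s) ≠ 0 := by linarith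
    have hs : s ≠ 0 := hs0.ne'
    rw [show (s + s⁻¹) / 2 + 1 = (1 + s) ^ 2 / (2 * s) by field_simp; ring,
      show (s + s⁻¹) / 2 - 1 = (1 - s) ^ 2 / (2 * s) by field_simp; ring,
      div_div_div_cancel_right₀ (by positivity : (2 * s) ≠ 0), div_pow]
  rw [hc, hsh, hq, Real.log_pow]
  push_cast
  field_simp
  ring

/-- The image of `(0, ε)` under `s ↦ −log s` is `(−log ε, ∞)` (`0 < ε`). [folklore] -/
theorem image_neg_log_Ioo {ε : ℝ} (hε : 0 < ε) :
    (fun s => -Real.log s) '' Ioo 0 ε = Ioi (-Real.log ε) := by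
  ext t
  simp only [mem_image, mem_Ioo, mem_Ioi]
  constructor
  · rintro ⟨s, ⟨hs0, hsε⟩, rfl⟩
    have := Real.log_lt_log hs0 hsε
    linarith
  · intro ht
    refine ⟨Real.exp (-t), ⟨Real.exp_pos _, ?_⟩, by rw [Real.log_exp]; ring⟩
    calc Real.exp (-t) < Real.exp (- -Real.log ε) := Real.exp_lt_exp.mpr (by linarith)
      _ = ε := by rw [neg_neg, Real.exp_log hε]

/-- The substitution `s = e^{-t}`:
`∫_{t > −log ε} defectDensity t = (2/3) ∫_{s ∈ (0, ε]} (s + 1/s − ½(s−1/s)² log((1+s)/(1−s)))/s ds`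
for `0 < ε ≤ 1`. [cite: LovasAndai2017, Lemma 6] -/
theorem integral_defectDensity_subst {ε : ℝ} (hε0 : 0 < ε) (hε1 : ε ≤ 1) :
    ∫ t in Ioi (-Real.log ε), defectDensity t
      = 2 / 3 * ∫ s in Ioc (0:ℝ) ε,
          (s + s⁻¹ - (s - s⁻¹) ^ 2 / 2 * Real.log ((1 + s) / (1 - s))) / s := by
  rw [← image_neg_log_Ioo hε0, integral_image_eq_integral_abs_deriv_smul measurableSet_Ioo
    (f := fun s => -Real.log s) (f' := fun s => -s⁻¹)
    (fun s hs => ((Real.hasDerivAt_log hs.1.ne').neg).hasDerivWithinAt)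
    (fun s hs s' hs' h => Real.log_injOn_pos hs.1 hs'.1 (neg_injective h)),
    integral_Ioc_eq_integral_Ioo, ← integral_const_mul]
  refine setIntegral_congr_fun measurableSet_Ioo fun s hs => ?_
  obtain ⟨hs0, hsε⟩ := hs
  rw [abs_neg, abs_of_pos (inv_pos.mpr hs0), smul_eq_mul,
    defectDensity_neg_log hs0 (lt_of_lt_of_le hsε hε1)]

end Literature.Probability.RandomMatrix.LovasAndaiLemma6

namespace Literature.Probability.RandomMatrix

open LovasAndaiLemma6 in
/-- **Lovas–Andai 2017, Lemma 6** (the normalised defect function `χ̃₁ = χ₁/χ₁(1)` of the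
operator-norm unit ball of `ℝ^{2×2}`): for `0 < ε ≤ 1`,
`χ₁(ε)/χ₁(1) = (4/π²) ∫₀^ε (s + 1/s − ½(s − 1/s)² log((1+s)/(1−s))) (1/s) ds`.
Proof: parts I–III of this development (`LovasAndaiLemma6Norm`, `LovasAndaiLemma6Fiber`, this
file), formalizing the computation of [LovasAndai2017, Appendix A] in the coordinates
`(a, d | m, τ)` together with `χ₁(1) = 2π²/3` ([LovasAndai2017, §5]). [cite: LovasAndai2017, Lemma 6] -/
theorem LovasAndai2017_lemma6_holds : LovasAndai2017_lemma6 := by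
  intro ε hε0 hε1
  set I := ∫ s in Set.Ioc (0:ℝ) ε,
    (s + s⁻¹ - (s - s⁻¹) ^ 2 / 2 * Real.log ((1 + s) / (1 - s))) / s with hI_def
  have hδ : 0 ≤ -Real.log ε := by have := Real.log_nonpos hε0.le hε1; linarith
  have hexp : Real.exp (-(-Real.log ε)) = ε := by rw [neg_neg, Real.exp_log hε0]
  have hvol : lovasAndaiChiOne ε = ENNReal.ofReal (8 / 3 * I) := by
    rw [lovasAndaiChiOne_eq_volume_normSet, ← hexp, volume_normSet_eq_integral _ hδ,
      integral_defectDensity_subst hε0 hε1]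
    congr 1; ring
  have hI : 0 ≤ 8 / 3 * I := by
    have h1 : 0 ≤ ∫ t in Set.Ioi (-Real.log ε), defectDensity t :=
      setIntegral_nonneg measurableSet_Ioi fun t ht => defectDensity_nonneg (lt_of_le_of_lt hδ ht)
    rw [integral_defectDensity_subst hε0 hε1] at h1
    linarith
  rw [hvol, LovasAndaiLemma6.lovasAndaiChiOne_one, ENNReal.toReal_ofReal hI,
    ENNReal.toReal_ofReal (by positivity)]
  field_simp
  ring

end Literature.Probability.RandomMatrix

end
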